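import Literature.MathematicalPhysics.KineticTheory.PureQuarticEnergy
import Literature.MathematicalPhysics.KineticTheory.LangevinChainConfined
import Mathlib.Analysis.ODE.Gronwall
import Mathlib.Analysis.Complex.ExponentialBounds
import HarnessLib

/-!
# The driven purely quartic chain: pathwise energy identity, energy at scale `K⁴`, and the energy inequality with the dissipation

Topic `Literature/MathematicalPhysics/KineticTheory`. Third proof file of the provefact unit for
`CuneoEckmannHairerReyBellet2018_pureQuarticChain` (`PureQuarticChainNESS.lean`; CEHR 2018 =
Cuneo–Eckmann–Hairer–Rey-Bellet, EJP **23** (2018) no. 55, Thm 2.13 for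
`pureQuarticChain μ γ = ⟨μq⁴/4, r⁴/4, γ⟩`), preparing the Lyapunov condition H2 (CEHR Thm 5.1 /
Rem 5.2, §5, "the main contribution to the energy difference `H(z_{t*}) - H(z₀)` comes from (minus)
the dissipation integral `Γ(t*)`"). It is the analogue of `LangevinChainEnergyScale.lean` (written
for `pinnedChain`), but PIPELINE-AGNOSTIC: the deterministic statements are about ANY continuous
path `z` solving the integral equation of the driven chain,

  `z(t) = x + (0, η(t)) + ∫₀ᵗ Y(z(s)) ds`  on `[0, T]`   (`IsIntegralSolutionOn`),

so that they apply verbatim to the model-free flow `drivenFlow`/`langevinSolMap` of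
`LangevinChainConfined.lean` and to `OscillatorChain.chainFlow` of `LangevinChainSDE.lean` /
`PureQuarticSDE.lean` alike.

* `OscillatorChain.hamiltonian_smoothPart_eq_add_integral` — **the energy identity of the smooth
  part** `y = z - (0, η)` for ANY chain with `C¹` energy and continuous drift (pathwise form of
  CEHR (3.3)): `H(y(t)) = H(x) + ∫₀ᵗ ∑_i (∂_{q_i}H(y) η_i - γ w_i ȳ_i² - γ w_i ȳ_i η_i)`;
  `…hamiltonian_eq_smoothPart_add_shift`: `H(z(t)) = H(y(t)) + ∑_i (ȳ_i η_i + η_i²/2)(t)`.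
* `pureQuarticChain_partialQ_hamiltonian_quarticDilation` — mechanical similarity of the force,
  `∂_{q_i}H(aq, a²p) = a³ ∂_{q_i}H(q, p)`, whence the **linear energy bound at scale `K ≥ 1`**,
  `∑_i |∂_{q_i}H| + 2γ ∑_i |p_i| ≤ (C/K) H + C K³`, `C = pureQuarticEnergyConst μ γ N`
  (`pureQuarticChain_linearEnergyBound_scale`; the pinned chain needed a separate computation).
* `pureQuarticChain_hamiltonian_smoothPart_le_ceiling` — **Grönwall at scale `K`**: for
  `H(x) ≤ 2K⁴`, `‖η‖ ≤ M` on `[0, T]`, `C M T ≤ K`: `H(y(t)) ≤ 8K⁴` on `[0, T]`.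
* `pureQuarticChain_hamiltonian_le_sub_dissipation` — **the pathwise energy inequality**:
  `H(z(t)) ≤ H(x) - γ∫₀ᵗ ∑_i w_i ȳ_i² + 9 C T M K³ + N M (4K² + M/2)`.

Everything is PROVED; no definition, no named fact.

## References

* N. Cuneo, J.-P. Eckmann, M. Hairer, L. Rey-Bellet, EJP **23** (2018) no. 55 (arXiv:1712.09413),
  §3 eq. (3.3), §5 p. 11 (the events `A₁, Ã`), Lemma 5.10.
* L. D. Landau, E. M. Lifshitz, *Mechanics* (3rd ed., 1976), §10 (mechanical similarity).
-/

noncomputable section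

open MeasureTheory Filter Topology Set Metric intervalIntegral
open scoped NNReal

namespace Literature.MathematicalPhysics.KineticTheory.HeatConduction

open Literature.Analysis.ODE

variable {N : ℕ}

/-! ### Generic: the energy of the smooth part of a driven chain -/

namespace OscillatorChain

variable (P : OscillatorChain)

/-- The smooth part `y = z - (0, η)` of a solution of `z(t) = x + (0, η(t)) + ∫₀ᵗ Y(z)` is
`x + ∫₀ᵗ Y(z)`. [folklore] -/
theorem smoothPart_eq_add_integral {x : PhaseSpace N} {η : ℝ → Fin N → ℝ} {z : ℝ → PhaseSpace N}
    {T : ℝ} (hz : IsIntegralSolutionOn (P.drift N) (fun t => x + ((0 : Fin N → ℝ), η t)) z T)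
    {t : ℝ} (ht : t ∈ Icc 0 T) :
    z t - ((0 : Fin N → ℝ), η t) = x + ∫ s in (0 : ℝ)..t, P.drift N (z s) := by
  rw [hz t ht]
  ext i
  · simp
  · simp
    ring

/-- The full state is the smooth part shifted by the noise momentum:
`z = (y.1, y.2 + η)` for `y = z - (0, η)`. [folklore] -/
theorem eq_smoothPart_shift (z : PhaseSpace N) (e : Fin N → ℝ) :
    z = ((z - ((0 : Fin N → ℝ), e)).1, (z - ((0 : Fin N → ℝ), e)).2 + e) := by
  ext i <;> simp

/-- **The energy identity of the smooth part** (pathwise form of CEHR (3.3),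
`LH = ∑_b γ_b(T_b - p_b²)`, the noise momentum `η` in place of Itô's correction): for a chain with
`C¹` energy and continuous drift, a continuous solution `z` of
`z(t) = x + (0, η(t)) + ∫₀ᵗ Y(z(s)) ds` on `[0, T]` (`η` continuous) and `y = z - (0, η)`,
`H(y(t)) = H(x) + ∫₀ᵗ ∑_i (∂_{q_i}H(y) η_i - γ w_i ȳ_i² - γ w_i ȳ_i η_i) ds` on `[0, T]`
(`w_i = [i=0] + [i=N-1]`, `ȳ = y.2`; the derivative of `y` is `Y(z) = Y(y.1, y.2 + η)` and
`DH(y)·Y(y.1, y.2 + η)` is `OscillatorChain.fderiv_hamiltonian_drift_eq_sum`).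
[cite: CuneoEckmannHairerReyBellet2018, §3 eq. (3.3) and §5 p. 11] -/
theorem hamiltonian_smoothPart_eq_add_integral (hYc : Continuous (P.drift N))
    (hH1 : ContDiff ℝ 1 (P.hamiltonian N)) {x : PhaseSpace N} {η : ℝ → Fin N → ℝ}
    {z : ℝ → PhaseSpace N} (hzc : Continuous z) {T : ℝ}
    (hz : IsIntegralSolutionOn (P.drift N) (fun t => x + ((0 : Fin N → ℝ), η t)) z T)
    {t : ℝ} (ht : t ∈ Icc 0 T) :
    P.hamiltonian N (z t - ((0 : Fin N → ℝ), η t)) = P.hamiltonian N x +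
      ∫ s in (0 : ℝ)..t, ∑ i,
        (partialQ i (P.hamiltonian N) (z s - ((0 : Fin N → ℝ), η s)) * η s i -
          P.γ * bathWeight N i * (z s - ((0 : Fin N → ℝ), η s)).2 i ^ 2 -
          P.γ * bathWeight N i * (z s - ((0 : Fin N → ℝ), η s)).2 i * η s i) := by
  set H := P.hamiltonian N with hHdef
  set Y := P.drift N with hYdef
  have hHd : Differentiable ℝ H := hH1.differentiable one_ne_zero
  set y : ℝ → PhaseSpace N := fun s => x + ∫ r in (0 : ℝ)..s, Y (z r) with hydef
  have hy_deriv : ∀ s, HasDerivAt y (Y (z s)) s := fun s => by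
    have h1 : HasDerivAt (fun u => ∫ r in (0 : ℝ)..u, Y (z r)) (Y (z s)) s :=
      ((hYc.comp hzc).integral_hasStrictDerivAt 0 s).hasDerivAt
    exact h1.const_add x
  have hyc : Continuous y := continuous_iff_continuousAt.2 fun s => (hy_deriv s).continuousAt
  have hy_eq : ∀ s ∈ Icc 0 T, y s = z s - ((0 : Fin N → ℝ), η s) := fun s hs =>
    (P.smoothPart_eq_add_integral hz hs).symm
  have hz_y : ∀ s ∈ Icc 0 T, z s = ((y s).1, (y s).2 + η s) := fun s hs => by
    rw [hy_eq s hs]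
    exact eq_smoothPart_shift (z s) (η s)
  -- the derivative of the energy of the smooth part
  set ψ : ℝ → ℝ := fun s => fderiv ℝ H (y s) (Y (z s)) with hψ
  have hg_deriv : ∀ s, HasDerivAt (fun s => H (y s)) (ψ s) s := fun s =>
    (hHd (y s)).hasFDerivAt.comp_hasDerivAt s (hy_deriv s)
  have hψc : Continuous ψ := ((hH1.continuous_fderiv one_ne_zero).comp hyc).clm_apply (hYc.comp hzc)
  have hψ_eq : ∀ s ∈ Icc 0 T, ψ s = ∑ i, (partialQ i H (y s) * η s i -
      P.γ * bathWeight N i * (y s).2 i ^ 2 - P.γ * bathWeight N i * (y s).2 i * η s i) := by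
    intro s hs
    simp only [hψ]
    rw [hz_y s hs]
    exact P.fderiv_hamiltonian_drift_eq_sum hHd (y s) (η s)
  -- the fundamental theorem of calculus
  have hFTC : ∫ s in (0 : ℝ)..t, ψ s = H (y t) - H (y 0) :=
    integral_eq_sub_of_hasDerivAt (fun s _ => hg_deriv s) (hψc.intervalIntegrable 0 t)
  have hy0 : y 0 = x := by simp [hydef]
  have hcongr : ∫ s in (0 : ℝ)..t, ψ s = ∫ s in (0 : ℝ)..t, ∑ i,
      (partialQ i H (z s - ((0 : Fin N → ℝ), η s)) * η s i -
        P.γ * bathWeight N i * (z s - ((0 : Fin N → ℝ), η s)).2 i ^ 2 -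
        P.γ * bathWeight N i * (z s - ((0 : Fin N → ℝ), η s)).2 i * η s i) :=
    integral_congr fun s hs => by
      have hs' : s ∈ Icc 0 T := by
        rw [uIcc_of_le ht.1] at hs
        exact ⟨hs.1, hs.2.trans ht.2⟩
      rw [hψ_eq s hs', hy_eq s hs']
  rw [← hy_eq t ht, ← hcongr, hFTC, hy0]
  ring

/-- **The energy of the full state from that of the smooth part**:
`H(z) = H(y) + ∑_i (ȳ_i η_i + η_i²/2)` for `y = z - (0, η)` (a momentum translation).
[folklore] -/
theorem hamiltonian_eq_smoothPart_add_shift (z : PhaseSpace N) (e : Fin N → ℝ) :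
    P.hamiltonian N z = P.hamiltonian N (z - ((0 : Fin N → ℝ), e)) +
      ∑ i, ((z - ((0 : Fin N → ℝ), e)).2 i * e i + e i ^ 2 / 2) := by
  conv_lhs => rw [eq_smoothPart_shift z e]
  exact P.hamiltonian_add_momentum N (z - ((0 : Fin N → ℝ), e)) e

/-- **The forcing work is controlled by the force and the momenta**:
`|∑_i (∂_{q_i}H(y) η_i - γ w_i ȳ_i η_i)| ≤ ‖η‖ (∑_i |∂_{q_i}H(y)| + 2γ ∑_i |ȳ_i|)` (`γ ≥ 0`,
`w_i ∈ [0, 2]`). [folklore] -/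
theorem abs_sum_forcing_le (hγ : 0 ≤ P.γ) (y : PhaseSpace N) (e : Fin N → ℝ) :
    |∑ i, (partialQ i (P.hamiltonian N) y * e i - P.γ * bathWeight N i * y.2 i * e i)| ≤
      ‖e‖ * ((∑ i, |partialQ i (P.hamiltonian N) y|) + 2 * P.γ * ∑ i, |y.2 i|) := by
  refine (Finset.abs_sum_le_sum_abs _ _).trans ?_
  have hei : ∀ i, |e i| ≤ ‖e‖ := fun i => by rw [← Real.norm_eq_abs]; exact norm_le_pi_norm e i
  have hw0 : ∀ i, 0 ≤ bathWeight N i := fun i => by unfold bathWeight; split_ifs <;> norm_num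
  have hw2 : ∀ i, bathWeight N i ≤ 2 := fun i => by unfold bathWeight; split_ifs <;> norm_num
  have hterm : ∀ i, |partialQ i (P.hamiltonian N) y * e i - P.γ * bathWeight N i * y.2 i * e i| ≤
      ‖e‖ * |partialQ i (P.hamiltonian N) y| + ‖e‖ * (2 * P.γ * |y.2 i|) := by
    intro i
    refine (abs_sub _ _).trans (add_le_add ?_ ?_)
    · rw [abs_mul, mul_comm]
      exact mul_le_mul_of_nonneg_right (hei i) (abs_nonneg _)
    · rw [abs_mul, abs_mul, abs_mul, abs_of_nonneg hγ, abs_of_nonneg (hw0 i)]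
      calc P.γ * bathWeight N i * |y.2 i| * |e i| ≤ P.γ * 2 * |y.2 i| * ‖e‖ := by
            refine mul_le_mul ?_ (hei i) (abs_nonneg _) (by positivity)
            exact mul_le_mul_of_nonneg_right (mul_le_mul_of_nonneg_left (hw2 i) hγ) (abs_nonneg _)
        _ = ‖e‖ * (2 * P.γ * |y.2 i|) := by ring
  calc ∑ i, |partialQ i (P.hamiltonian N) y * e i - P.γ * bathWeight N i * y.2 i * e i|
      ≤ ∑ i, (‖e‖ * |partialQ i (P.hamiltonian N) y| + ‖e‖ * (2 * P.γ * |y.2 i|)) :=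
        Finset.sum_le_sum fun i _ => hterm i
    _ = ‖e‖ * ((∑ i, |partialQ i (P.hamiltonian N) y|) + 2 * P.γ * ∑ i, |y.2 i|) := by
        rw [Finset.sum_add_distrib, ← Finset.mul_sum, ← Finset.mul_sum, ← Finset.mul_sum, mul_add]

end OscillatorChain

/-! ### The purely quartic chain: mechanical similarity of the force, energy bounds at scale `K` -/

section PureQuartic

variable {μ γ : ℝ}

open OscillatorChain

/-- **Mechanical similarity, forces**: `∂_{q_i}H(a q, a² p) = a³ ∂_{q_i}H(q, p)` for the purely
quartic chain (`a ≠ 0`; from `H ∘ S_a = a⁴ H` and the chain rule).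
[cite: LandauLifshitzMechanics1976, §10] -/
theorem pureQuarticChain_partialQ_hamiltonian_quarticDilation (μ γ : ℝ) {a : ℝ} (ha : a ≠ 0)
    (N : ℕ) (i : Fin N) (x : PhaseSpace N) :
    partialQ i ((pureQuarticChain μ γ).hamiltonian N) (quarticDilation a x) =
      a ^ 3 * partialQ i ((pureQuarticChain μ γ).hamiltonian N) x := by
  set H := (pureQuarticChain μ γ).hamiltonian N with hH
  have hfun : (fun y => H (quarticDilation a y)) = fun y => a ^ 4 * H y :=
    funext fun y => pureQuarticChain_hamiltonian_quarticDilation μ γ a N y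
  have h1 := partialQ_comp_quarticDilation a i H x
  rw [hfun, partialQ_const_mul_eq] at h1
  have key : a * partialQ i H (quarticDilation a x) = a * (a ^ 3 * partialQ i H x) := by
    rw [← h1]; ring
  exact mul_left_cancel₀ ha key

/-- **The linear energy bound at scale `K ≥ 1`** for the purely quartic chain (`μ > 0`, `γ ≥ 0`):
`∑_i |∂_{q_i}H(x)| + 2γ ∑_i |p_i| ≤ (C/K) H(x) + C K³` with `C = pureQuarticEnergyConst μ γ N`
— the bound of `PureQuarticEnergy.lean` at `K = 1` transported by the mechanical similarity
`x = S_K x'`: forces scale like `K³`, momenta like `K² ≤ K³`, energies like `K⁴`.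
[cite: CuneoEckmannHairerReyBellet2018, Lemma 5.10] -/
theorem pureQuarticChain_linearEnergyBound_scale (hμ : 0 < μ) (hγ : 0 ≤ γ) (N : ℕ) {K : ℝ}
    (hK : 1 ≤ K) (x : PhaseSpace N) :
    (∑ i, |partialQ i ((pureQuarticChain μ γ).hamiltonian N) x|) + 2 * γ * ∑ i, |x.2 i| ≤
      pureQuarticEnergyConst μ γ N / K * (pureQuarticChain μ γ).hamiltonian N x +
        pureQuarticEnergyConst μ γ N * K ^ 3 := by
  set H := (pureQuarticChain μ γ).hamiltonian N with hH
  set C := pureQuarticEnergyConst μ γ N with hC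
  have hK0 : 0 < K := by linarith
  have hC0 : 0 ≤ C := pureQuarticEnergyConst_nonneg hμ γ N
  set x' : PhaseSpace N := quarticDilation K⁻¹ x with hx'
  have hxx' : x = quarticDilation K x' := by
    rw [hx', ← quarticDilation_mul, mul_inv_cancel₀ hK0.ne', quarticDilation_one]
  have hHx : H x = K ^ 4 * H x' := by
    rw [hxx']; exact pureQuarticChain_hamiltonian_quarticDilation μ γ K N x'
  have hFx : ∀ i, partialQ i H x = K ^ 3 * partialQ i H x' := fun i => by
    conv_lhs => rw [hxx']
    exact pureQuarticChain_partialQ_hamiltonian_quarticDilation μ γ hK0.ne' N i x'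
  have hpx : ∀ i, x.2 i = K ^ 2 * x'.2 i := fun i => by
    conv_lhs => rw [hxx']
    simp [quarticDilation]
  have h1 := pureQuarticChain_linearEnergyBound hμ hγ N x'
  have hH0 : 0 ≤ H x' := pureQuarticChain_hamiltonian_nonneg hμ.le γ N x'
  have hs1 : ∑ i, |partialQ i H x| = K ^ 3 * ∑ i, |partialQ i H x'| := by
    rw [Finset.mul_sum]
    refine Finset.sum_congr rfl fun i _ => ?_
    rw [hFx i, abs_mul, abs_of_pos (by positivity)]
  have hs2 : ∑ i, |x.2 i| = K ^ 2 * ∑ i, |x'.2 i| := by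
    rw [Finset.mul_sum]
    refine Finset.sum_congr rfl fun i _ => ?_
    rw [hpx i, abs_mul, abs_of_pos (by positivity)]
  have hp0 : 0 ≤ ∑ i, |x'.2 i| := Finset.sum_nonneg fun i _ => abs_nonneg _
  have hK23 : K ^ 2 ≤ K ^ 3 := by nlinarith
  rw [hs1, hs2, hHx]
  have e1 : C / K * (K ^ 4 * H x') = C * K ^ 3 * H x' := by
    field_simp
  rw [e1]
  have h2 : 2 * γ * (K ^ 2 * ∑ i, |x'.2 i|) ≤ K ^ 3 * (2 * γ * ∑ i, |x'.2 i|) := by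
    have := mul_le_mul_of_nonneg_left hK23 (mul_nonneg (by positivity : (0 : ℝ) ≤ 2 * γ) hp0)
    nlinarith
  have h3 : K ^ 3 * ((∑ i, |partialQ i H x'|) + 2 * γ * ∑ i, |x'.2 i|) ≤ K ^ 3 * (C * (1 + H x')) :=
    mul_le_mul_of_nonneg_left h1 (by positivity)
  nlinarith

/-- `|p_i| ≤ 4K²` when the energy is at most `8K⁴` (`μ ≥ 0`). [folklore] -/
theorem pureQuarticChain_abs_momentum_le_of_le (hμ : 0 ≤ μ) (γ : ℝ) (N : ℕ) {K : ℝ}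
    {y : PhaseSpace N} (hy : (pureQuarticChain μ γ).hamiltonian N y ≤ 8 * K ^ 4) (i : Fin N) :
    |y.2 i| ≤ 4 * K ^ 2 := by
  have h := pureQuarticChain_sq_le_hamiltonian hμ γ N y i
  have h1 : y.2 i ^ 2 ≤ (4 * K ^ 2) ^ 2 := by nlinarith
  have h2 := sq_le_sq.1 h1
  rwa [abs_of_nonneg (by positivity : (0 : ℝ) ≤ 4 * K ^ 2)] at h2

/-- **Grönwall at scale `K ≥ 1`, the energy ceiling** (CEHR §5 p. 11, the event `Ã`: on a short
window the energy does not increase much; here pathwise for a bounded noise path): for the purely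
quartic chain (`μ > 0`, `γ ≥ 0`), a continuous solution `z` of `z(t) = x + (0,η(t)) + ∫₀ᵗ Y(z)`
on `[0, T]` with `H(x) ≤ 2K⁴`, `‖η‖ ≤ M` on `[0, T]` and `C M T ≤ K`
(`C = pureQuarticEnergyConst`), the smooth part `y = z - (0, η)` satisfies `H(y(t)) ≤ 8K⁴` on
`[0, T]`: `(H∘y)' = DH(y)·Y(y.1, y.2 + η) ≤ ‖η‖(∑|∂_qH| + 2γ∑|ȳ|) ≤ (CM/K)(H∘y + K⁴)`, so
`H(y(t)) + K⁴ ≤ 3K⁴ e^{CMt/K} ≤ 3eK⁴`. [cite: CuneoEckmannHairerReyBellet2018, §5 p. 11 and Lemma 5.10] -/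
theorem pureQuarticChain_hamiltonian_smoothPart_le_ceiling (hμ : 0 < μ) (hγ : 0 ≤ γ) (N : ℕ)
    {K : ℝ} (hK : 1 ≤ K) {x : PhaseSpace N}
    (hx : (pureQuarticChain μ γ).hamiltonian N x ≤ 2 * K ^ 4)
    {η : ℝ → Fin N → ℝ} {z : ℝ → PhaseSpace N} (hzc : Continuous z)
    {T M : ℝ} (hM : ∀ t ∈ Icc 0 T, ‖η t‖ ≤ M)
    (hMT : pureQuarticEnergyConst μ γ N * M * T ≤ K)
    (hz : IsIntegralSolutionOn ((pureQuarticChain μ γ).drift N)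
      (fun t => x + ((0 : Fin N → ℝ), η t)) z T) :
    ∀ t ∈ Icc 0 T, (pureQuarticChain μ γ).hamiltonian N (z t - ((0 : Fin N → ℝ), η t)) ≤ 8 * K ^ 4 := by
  intro t ht
  set P := pureQuarticChain μ γ with hP
  set H := P.hamiltonian N with hHdef
  set Y := P.drift N with hYdef
  set C := pureQuarticEnergyConst μ γ N with hC
  have hT : 0 ≤ T := ht.1.trans ht.2
  have hM0 : 0 ≤ M := (norm_nonneg _).trans (hM 0 ⟨le_rfl, hT⟩)
  have hK0 : 0 < K := by linarith
  have hC0 : 0 ≤ C := pureQuarticEnergyConst_nonneg hμ γ N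
  have hYc : Continuous Y := (pureQuarticChain_contDiff_drift μ γ N (n := 0)).continuous
  have hHs : ContDiff ℝ 1 H := pureQuarticChain_contDiff_hamiltonian μ γ N
  have hHd : Differentiable ℝ H := hHs.differentiable one_ne_zero
  set y : ℝ → PhaseSpace N := fun s => x + ∫ r in (0 : ℝ)..s, Y (z r) with hydef
  have hy_deriv : ∀ s, HasDerivAt y (Y (z s)) s := fun s => by
    have h1 : HasDerivAt (fun u => ∫ r in (0 : ℝ)..u, Y (z r)) (Y (z s)) s :=
      ((hYc.comp hzc).integral_hasStrictDerivAt 0 s).hasDerivAt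
    exact h1.const_add x
  have hy_eq : ∀ s ∈ Icc 0 T, y s = z s - ((0 : Fin N → ℝ), η s) := fun s hs =>
    (P.smoothPart_eq_add_integral hz hs).symm
  have hz_y : ∀ s ∈ Icc 0 T, z s = ((y s).1, (y s).2 + η s) := fun s hs => by
    rw [hy_eq s hs]
    exact eq_smoothPart_shift (z s) (η s)
  set f : ℝ → ℝ := fun s => H (y s) + K ^ 4 with hfdef
  have hf_deriv : ∀ s, HasDerivAt f (fderiv ℝ H (y s) (Y (z s))) s := fun s =>
    ((hHd (y s)).hasFDerivAt.comp_hasDerivAt s (hy_deriv s)).add_const (K ^ 4)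
  have hf_cont : Continuous f := continuous_iff_continuousAt.2 fun s => (hf_deriv s).continuousAt
  have hbound : ∀ s ∈ Ico 0 T, fderiv ℝ H (y s) (Y (z s)) ≤ (C * M / K) * f s + 0 := by
    intro s hs
    have hs' : s ∈ Icc 0 T := ⟨hs.1, hs.2.le⟩
    rw [hz_y s hs']
    have hγ' : 0 ≤ P.γ := hγ
    have h := P.fderiv_hamiltonian_drift_le hHd hγ' (y s) (η s)
    have hsc := pureQuarticChain_linearEnergyBound_scale hμ hγ N hK (y s)
    have hH0 : 0 ≤ H (y s) := pureQuarticChain_hamiltonian_nonneg hμ.le γ N (y s)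
    have hηs : ‖η s‖ ≤ M := hM s hs'
    have hnn : 0 ≤ (∑ i, |partialQ i H (y s)|) + 2 * P.γ * ∑ i, |(y s).2 i| := by
      have : 0 ≤ ∑ i, |partialQ i H (y s)| := Finset.sum_nonneg fun i _ => abs_nonneg _
      have : 0 ≤ ∑ i, |(y s).2 i| := Finset.sum_nonneg fun i _ => abs_nonneg _
      positivity
    have hPγ : P.γ = γ := rfl
    calc fderiv ℝ H (y s) (Y ((y s).1, (y s).2 + η s))
        ≤ ‖η s‖ * ((∑ i, |partialQ i H (y s)|) + 2 * P.γ * ∑ i, |(y s).2 i|) := h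
      _ ≤ M * (C / K * H (y s) + C * K ^ 3) := by
          rw [hPγ]; exact mul_le_mul hηs hsc hnn hM0
      _ = (C * M / K) * f s + 0 := by
          simp only [hfdef]
          field_simp
          ring
  have hf0 : f 0 ≤ 3 * K ^ 4 := by
    simp only [hfdef, hydef, integral_same, add_zero]
    linarith
  have hG := le_gronwallBound_of_liminf_deriv_right_le (f := f)
    (f' := fun s => fderiv ℝ H (y s) (Y (z s))) (δ := 3 * K ^ 4) (K := C * M / K) (ε := 0) (a := 0)
    (b := T) hf_cont.continuousOn (fun s _ r hr => ?_) hf0 hbound t ht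
  · rw [sub_zero, gronwallBound_ε0] at hG
    have hexp : Real.exp (C * M / K * t) ≤ 3 := by
      have h2 : C * M / K * t ≤ 1 := by
        rw [div_mul_eq_mul_div, div_le_one hK0]
        calc C * M * t ≤ C * M * T := mul_le_mul_of_nonneg_left ht.2 (by positivity)
          _ ≤ K := hMT
      calc Real.exp (C * M / K * t) ≤ Real.exp 1 := Real.exp_le_exp.2 h2
        _ ≤ 3 := Real.exp_one_lt_three.le
    have hfin : f t = H (z t - ((0 : Fin N → ℝ), η t)) + K ^ 4 := by
      show H (y t) + K ^ 4 = _
      rw [hy_eq t ht]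
    rw [hfin] at hG
    have h3 : 3 * K ^ 4 * Real.exp (C * M / K * t) ≤ 3 * K ^ 4 * 3 :=
      mul_le_mul_of_nonneg_left hexp (by positivity)
    linarith
  · have := ((hf_deriv s).hasDerivWithinAt (s := Ici s)).liminf_right_slope_le hr
    refine this.mono fun w hw => ?_
    rwa [slope_def_field, div_eq_inv_mul] at hw

/-- **The pathwise energy inequality with the dissipation** (CEHR §5, p. 11: "the main
contribution to the energy difference `H(z_{t*}) - H(z₀)` comes from (minus) the dissipation
integral"): under the hypotheses of the ceiling lemma, for `t ∈ [0, T]`,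
`H(z(t)) ≤ H(x) - γ ∫₀ᵗ ∑_i w_i ȳ_i² + 9 C T M K³ + N M (4K² + M/2)` (the forcing work is
`≤ ∫ ‖η‖(∑|∂_qH(y)| + 2γ∑|ȳ|) ≤ T M ((C/K) 8K⁴ + C K³)`, the final momentum shift
`≤ ∑ (|ȳ_i||η_i| + η_i²/2) ≤ N M (4K² + M/2)`).
[cite: CuneoEckmannHairerReyBellet2018, §5 p. 11 and Lemma 5.10] -/
theorem pureQuarticChain_hamiltonian_le_sub_dissipation (hμ : 0 < μ) (hγ : 0 ≤ γ) (N : ℕ)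
    {K : ℝ} (hK : 1 ≤ K) {x : PhaseSpace N}
    (hx : (pureQuarticChain μ γ).hamiltonian N x ≤ 2 * K ^ 4)
    {η : ℝ → Fin N → ℝ} (hη : Continuous η) {z : ℝ → PhaseSpace N} (hzc : Continuous z)
    {T M : ℝ} (hM : ∀ t ∈ Icc 0 T, ‖η t‖ ≤ M)
    (hMT : pureQuarticEnergyConst μ γ N * M * T ≤ K)
    (hz : IsIntegralSolutionOn ((pureQuarticChain μ γ).drift N)
      (fun t => x + ((0 : Fin N → ℝ), η t)) z T) {t : ℝ} (ht : t ∈ Icc 0 T) :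
    (pureQuarticChain μ γ).hamiltonian N (z t) ≤
      (pureQuarticChain μ γ).hamiltonian N x -
        γ * (∫ s in (0 : ℝ)..t, ∑ i, bathWeight N i * (z s - ((0 : Fin N → ℝ), η s)).2 i ^ 2) +
        9 * pureQuarticEnergyConst μ γ N * T * M * K ^ 3 + N * M * (4 * K ^ 2 + M / 2) := by
  set P := pureQuarticChain μ γ with hP
  set H := P.hamiltonian N with hHdef
  set C := pureQuarticEnergyConst μ γ N with hC
  have hT : 0 ≤ T := ht.1.trans ht.2
  have hM0 : 0 ≤ M := (norm_nonneg _).trans (hM 0 ⟨le_rfl, hT⟩)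
  have hK0 : 0 < K := by linarith
  have hC0 : 0 ≤ C := pureQuarticEnergyConst_nonneg hμ γ N
  have hYc : Continuous (P.drift N) := (pureQuarticChain_contDiff_drift μ γ N (n := 0)).continuous
  have hHs : ContDiff ℝ 1 H := pureQuarticChain_contDiff_hamiltonian μ γ N
  have hPγ : P.γ = γ := rfl
  -- the energy ceiling and the bounds it implies along `[0, T]`
  have hceil : ∀ s ∈ Icc 0 T, H (z s - ((0 : Fin N → ℝ), η s)) ≤ 8 * K ^ 4 :=
    pureQuarticChain_hamiltonian_smoothPart_le_ceiling hμ hγ N hK hx hzc hM hMT hz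
  have hforce : ∀ s ∈ Icc 0 T,
      (∑ i, |partialQ i H (z s - ((0 : Fin N → ℝ), η s))|) +
          2 * γ * ∑ i, |(z s - ((0 : Fin N → ℝ), η s)).2 i| ≤ 9 * C * K ^ 3 := by
    intro s hs
    have h1 := pureQuarticChain_linearEnergyBound_scale hμ hγ N hK (z s - ((0 : Fin N → ℝ), η s))
    have h2 : C / K * H (z s - ((0 : Fin N → ℝ), η s)) ≤ C / K * (8 * K ^ 4) :=
      mul_le_mul_of_nonneg_left (hceil s hs) (by positivity)
    have h3 : C / K * (8 * K ^ 4) = 8 * C * K ^ 3 := by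
      rw [div_mul_eq_mul_div, div_eq_iff hK0.ne']
      ring
    linarith
  have hmom : ∀ s ∈ Icc 0 T, ∀ i, |(z s - ((0 : Fin N → ℝ), η s)).2 i| ≤ 4 * K ^ 2 :=
    fun s hs i => pureQuarticChain_abs_momentum_le_of_le hμ.le γ N (hceil s hs) i
  -- continuity of the two integrands
  have hyc : Continuous fun s => z s - ((0 : Fin N → ℝ), η s) :=
    hzc.sub (continuous_const.prodMk hη)
  have hQc : ∀ i, Continuous fun s => partialQ i H (z s - ((0 : Fin N → ℝ), η s)) := fun i =>
    (P.continuous_partialQ_hamiltonian hHs i).comp hyc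
  have hy2c : ∀ i, Continuous fun s => (z s - ((0 : Fin N → ℝ), η s)).2 i := fun i =>
    (continuous_apply i).comp (continuous_snd.comp hyc)
  have hηc : ∀ i, Continuous fun s => η s i := fun i => (continuous_apply i).comp hη
  set W : ℝ → ℝ := fun s => ∑ i, (partialQ i H (z s - ((0 : Fin N → ℝ), η s)) * η s i -
    P.γ * bathWeight N i * (z s - ((0 : Fin N → ℝ), η s)).2 i * η s i) with hW
  set Dis : ℝ → ℝ := fun s => ∑ i, bathWeight N i * (z s - ((0 : Fin N → ℝ), η s)).2 i ^ 2 with hDis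
  have hWc : Continuous W := by
    simp only [hW]
    exact continuous_finsetSum _ fun i _ =>
      ((hQc i).mul (hηc i)).sub (((continuous_const.mul (hy2c i))).mul (hηc i))
  have hDisc : Continuous Dis := by
    simp only [hDis]
    exact continuous_finsetSum _ fun i _ => continuous_const.mul ((hy2c i).pow 2)
  -- the identity, split into work and dissipation
  have hid := P.hamiltonian_smoothPart_eq_add_integral hYc hHs hzc hz ht
  have hsplit : ∫ s in (0 : ℝ)..t, ∑ i,
      (partialQ i H (z s - ((0 : Fin N → ℝ), η s)) * η s i -
        P.γ * bathWeight N i * (z s - ((0 : Fin N → ℝ), η s)).2 i ^ 2 -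
        P.γ * bathWeight N i * (z s - ((0 : Fin N → ℝ), η s)).2 i * η s i) =
      (∫ s in (0 : ℝ)..t, W s) - γ * ∫ s in (0 : ℝ)..t, Dis s := by
    have hpt : ∀ s, ∑ i, (partialQ i H (z s - ((0 : Fin N → ℝ), η s)) * η s i -
        P.γ * bathWeight N i * (z s - ((0 : Fin N → ℝ), η s)).2 i ^ 2 -
        P.γ * bathWeight N i * (z s - ((0 : Fin N → ℝ), η s)).2 i * η s i) = W s - γ * Dis s := by
      intro s
      simp only [hW, hDis, hPγ]
      rw [Finset.mul_sum, ← Finset.sum_sub_distrib]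
      exact Finset.sum_congr rfl fun i _ => by ring
    simp_rw [hpt]
    rw [integral_sub (hWc.intervalIntegrable _ _) ((hDisc.const_mul γ).intervalIntegrable _ _),
      intervalIntegral.integral_const_mul]
  -- the forcing work
  have hwork : ∫ s in (0 : ℝ)..t, W s ≤ t * (M * (9 * C * K ^ 3)) := by
    have hb : ∀ s ∈ uIoc (0 : ℝ) t, ‖W s‖ ≤ M * (9 * C * K ^ 3) := by
      intro s hs
      have hs' : s ∈ Icc 0 T := by
        rw [uIoc_of_le ht.1] at hs
        exact ⟨hs.1.le, hs.2.trans ht.2⟩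
      rw [Real.norm_eq_abs]
      have hγ' : 0 ≤ P.γ := hγ
      refine (P.abs_sum_forcing_le hγ' (z s - ((0 : Fin N → ℝ), η s)) (η s)).trans ?_
      rw [hPγ]
      have h0 : 0 ≤ (∑ i, |partialQ i H (z s - ((0 : Fin N → ℝ), η s))|) +
          2 * γ * ∑ i, |(z s - ((0 : Fin N → ℝ), η s)).2 i| := by
        have : 0 ≤ ∑ i, |partialQ i H (z s - ((0 : Fin N → ℝ), η s))| :=
          Finset.sum_nonneg fun i _ => abs_nonneg _
        have : 0 ≤ ∑ i, |(z s - ((0 : Fin N → ℝ), η s)).2 i| := Finset.sum_nonneg fun i _ => abs_nonneg _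
        positivity
      exact mul_le_mul (hM s hs') (hforce s hs') h0 hM0
    have h := intervalIntegral.norm_integral_le_of_norm_le_const hb
    rw [Real.norm_eq_abs, sub_zero, abs_of_nonneg ht.1] at h
    have := le_abs_self (∫ s in (0 : ℝ)..t, W s)
    nlinarith
  -- the final-time correction
  have hfin : ∑ i, ((z t - ((0 : Fin N → ℝ), η t)).2 i * η t i + η t i ^ 2 / 2) ≤
      N * M * (4 * K ^ 2 + M / 2) := by
    have hηi : ∀ i, |η t i| ≤ M := fun i =>
      (show |η t i| ≤ ‖η t‖ by rw [← Real.norm_eq_abs]; exact norm_le_pi_norm (η t) i).trans (hM t ht)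
    have hterm : ∀ i, (z t - ((0 : Fin N → ℝ), η t)).2 i * η t i + η t i ^ 2 / 2 ≤
        M * (4 * K ^ 2 + M / 2) := by
      intro i
      have h1 : (z t - ((0 : Fin N → ℝ), η t)).2 i * η t i ≤ 4 * K ^ 2 * M := by
        calc (z t - ((0 : Fin N → ℝ), η t)).2 i * η t i
            ≤ |(z t - ((0 : Fin N → ℝ), η t)).2 i * η t i| := le_abs_self _
          _ = |(z t - ((0 : Fin N → ℝ), η t)).2 i| * |η t i| := abs_mul _ _
          _ ≤ 4 * K ^ 2 * M := mul_le_mul (hmom t ht i) (hηi i) (abs_nonneg _) (by positivity)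
      have h2 : η t i ^ 2 ≤ M ^ 2 := by
        rw [← sq_abs]
        exact pow_le_pow_left₀ (abs_nonneg _) (hηi i) 2
      nlinarith
    calc ∑ i, ((z t - ((0 : Fin N → ℝ), η t)).2 i * η t i + η t i ^ 2 / 2)
        ≤ ∑ _i : Fin N, M * (4 * K ^ 2 + M / 2) := Finset.sum_le_sum fun i _ => hterm i
      _ = N * M * (4 * K ^ 2 + M / 2) := by
          simp only [Finset.sum_const, Finset.card_univ, Fintype.card_fin, nsmul_eq_mul]
          ring
  have hzt := P.hamiltonian_eq_smoothPart_add_shift (z t) (η t)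
  have ht0 : t * (M * (9 * C * K ^ 3)) ≤ 9 * C * T * M * K ^ 3 := by
    have := mul_le_mul_of_nonneg_right ht.2 (by positivity : 0 ≤ M * (9 * C * K ^ 3))
    linarith
  rw [hsplit] at hid
  rw [← hHdef] at hzt hid
  linarith [hwork, hfin, hzt, hid, ht0]

end PureQuartic

end Literature.MathematicalPhysics.KineticTheory.HeatConduction
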